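import Mathlib
import Summits.NavierStokesRegularity.NavierStokesRegularity.Theorems.ThreadingFluxCentreJetRigidityReduction
import Summits.NavierStokesRegularity.NavierStokesRegularity.Theorems.ThreadingFluxCentreJetSteadyFacts
import Summits.NavierStokesRegularity.NavierStokesRegularity.Theorems.ThreadingFluxCentreJetAnalyticPrimitive
import Summits.NavierStokesRegularity.NavierStokesRegularity.Theorems.ThreadingFluxCentreJetFirstLemmas
import HarnessLib

/-!
# Crux `PoloidalLiouville` (stmt-NavierStokesRegularity-1222, wall W1), crux idea «steady-centre-sieve» (ns-idea-15 g5):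
# the reductions R2 / R2* WITHOUT literature hypotheses — the steady stratum of W1 follows from the rigidity conjecture ALONE

Support file (Theorems-side; seat ns-wall-eng-7 g5, cell ns-wall-extremal, W1 adjunct; `--supports stmt-NavierStokesRegularity-1222
--as helper`).  The card states R2 `NoTypeNCentreOfRigidity : F1 → F2 → G1 → C1 → R1` and R2* `SteadyStratumOfRigidity : F1 → F2 → G1 →
C1* → R3 → W1ˢ` over three literature facts F1 (analyticity), F2 (gradient bounds), G1 (classical ⇒ mild) «to port».  For the
reductions every one of them is a THEOREM of the tree in the case that matters (bounded classical steady flows on all of `ℝ³`):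

* F2, G1: `CentreJet.steadyNSGradientBounds`, `CentreJet.steadyClassicalIsMild` (`ThreadingFluxCentreJetSteadyFacts.lean`);
* velocity analyticity: `CentreJet.analyticOnNhd_of_isSteadyNSOn_univ` (tree `IsSteadyNSSolution.analyticOnNhd_of_bounded`);
* PRESSURE analyticity (this file, `CentreJet.analyticOnNhd_pressure_of_isSteadyNSOn_univ`): `∇p = ΔV − (V·∇)V` is real-analytic, and a
  differentiable function with real-analytic derivative is real-analytic (`CentreJet.analyticOnNhd_of_fderiv`,
  `ThreadingFluxCentreJetAnalyticPrimitive.lean`);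
* R3: `CentreJet.irrotationalSteadyLiouville` (`ThreadingFluxCentreJetFirstLemmas.lean`).

Hence the SHARP reductions, bodies of C1/C1*/R1/W1ˢ verbatim from the sketch:

* `CentreJet.noTypeNCentre_of_steadyLocalRigidityN : SteadyLocalRigidityN → NoTypeNCentre`;
* `CentreJet.steadyUnthreadedLiouville_of_steadyLocalRigidity : SteadyLocalRigidity → SteadyUnthreadedLiouville`.

HONEST LABEL: the load-bearing statements C1 `SteadyLocalRigidityN` / C1* `SteadyLocalRigidity` are CONJECTURES of the card (exact linearised
sieve evidence only) and are NOT touched here; `NoTypeNCentre`, `SteadyUnthreadedLiouville`, `PoloidalLiouville` (1222) and NS regularity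
remain OPEN; information-grade (movement 0).  [cite: KochNadirashviliSereginSverak2009, Thm 5.2 (arXiv pp. 9–10)]
-/

-- the summit and its single problem share the name (D-0017 nested layout)
set_option linter.dupNamespace false

noncomputable section

open Set Function Filter MeasureTheory
open scoped RealInnerProductSpace Topology
open Literature.Analysis.FluidPDE

namespace Summit.NavierStokesRegularity.NavierStokesRegularity.Theorems.PoloidalLiouville.CentreJet

/-! ### Pressure analyticity of bounded classical steady flows on `ℝ³` -/

/-- The right-hand side `x ↦ ΔV(x) − DV(x)[V(x)]` is real-analytic when `V` is. -/
theorem analyticOnNhd_laplacian_sub_convect {V : E3 → E3} (hV : AnalyticOnNhd ℝ V univ) :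
    AnalyticOnNhd ℝ (fun x => Laplacian.laplacian V x - fderiv ℝ V x (V x)) univ := by
  -- the Laplacian: a finite sum of evaluations of the (analytic) second derivative
  have hΔ : AnalyticOnNhd ℝ (Laplacian.laplacian V) univ := by
    rw [InnerProductSpace.laplacian_eq_iteratedFDeriv_orthonormalBasis V (EuclideanSpace.basisFun (Fin 3) ℝ)]
    have h2 : AnalyticOnNhd ℝ (iteratedFDeriv ℝ 2 V) univ := hV.iteratedFDeriv 2
    refine Finset.analyticOnNhd_fun_sum _ fun i _ => ?_
    exact (ContinuousMultilinearMap.apply ℝ (fun _ : Fin 2 => E3) E3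
      ![(EuclideanSpace.basisFun (Fin 3) ℝ) i, (EuclideanSpace.basisFun (Fin 3) ℝ) i]).comp_analyticOnNhd h2
  -- the convective term: the bilinear evaluation `(L, v) ↦ L v` composed with `x ↦ (DV(x), V(x))`
  have hconv : AnalyticOnNhd ℝ (fun x => fderiv ℝ V x (V x)) univ := by
    have hb := (ContinuousLinearMap.id ℝ (E3 →L[ℝ] E3)).analyticOnNhd_bilinear (univ : Set ((E3 →L[ℝ] E3) × E3))
    exact hb.comp (hV.fderiv.prod hV) (mapsTo_univ _ _)
  exact hΔ.sub hconv

/-- **The pressure of a bounded classical steady Navier–Stokes flow on `ℝ³` is real-analytic**: its gradient `∇p = ΔV − (V·∇)V` is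
real-analytic (velocity analyticity, tree) and a differentiable function with real-analytic derivative is real-analytic. -/
theorem analyticOnNhd_pressure_of_isSteadyNSOn_univ {V : E3 → E3} {p : E3 → ℝ} (h : IsSteadyNSOn univ V p)
    (hB : ∃ B : ℝ, ∀ x, ‖V x‖ ≤ B) : AnalyticOnNhd ℝ p univ := by
  have hVan := analyticOnNhd_of_isSteadyNSOn_univ h hB
  have hpd : DifferentiableOn ℝ p univ := h.2.1.differentiableOn one_ne_zero
  refine analyticOnNhd_of_fderiv isOpen_univ hpd ?_
  have heq : fderiv ℝ p = fun x =>
      (InnerProductSpace.toDual ℝ E3 : E3 →L[ℝ] (E3 →L[ℝ] ℝ)) (Laplacian.laplacian V x - fderiv ℝ V x (V x)) := by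
    funext x
    have h4 := h.2.2.2 x (mem_univ x)
    have hg : gradient p x = Laplacian.laplacian V x - fderiv ℝ V x (V x) := by rw [← h4]; abel
    rw [← hg, gradient]
    simp
  rw [heq]
  exact (InnerProductSpace.toDual ℝ E3 : E3 →L[ℝ] (E3 →L[ℝ] ℝ)).comp_analyticOnNhd (analyticOnNhd_laplacian_sub_convect hVan)

/-! ### The sharp reductions -/

/-- ★★ **R2 without literature hypotheses: `SteadyLocalRigidityN → NoTypeNCentre`** (bodies verbatim).  Given ONLY the (conjectural)
type-N local rigidity C1, a bounded classical steady Navier–Stokes flow on `ℝ³` unthreaded about `x₀` has `ΔV(x₀) = 0`. -/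
theorem noTypeNCentre_of_steadyLocalRigidityN :
    (∀ (V : E3 → E3) (p : E3 → ℝ) (x₀ : E3) (ρ : ℝ), 0 < ρ →
      AnalyticOnNhd ℝ V (Metric.ball x₀ ρ) → AnalyticOnNhd ℝ p (Metric.ball x₀ ρ) →
      IsSteadyNSOn (Metric.ball x₀ ρ) V p → (∀ x ∈ Metric.ball x₀ ρ, inner ℝ (x - x₀) (curl V x) = 0) →
      Laplacian.laplacian V x₀ ≠ 0 →
      ∃ g : E3 ≃ₗᵢ[ℝ] E3, (∃ a : ℝ, g (EuclideanSpace.single (2 : Fin 3) (1 : ℝ)) = a • Laplacian.laplacian V x₀) ∧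
        (∀ θ : ℝ, ∀ y : E3, ‖y‖ < ρ → g.symm (V (x₀ + g (rotZ θ y))) = rotZ θ (g.symm (V (x₀ + g y)))) ∧
        ∀ y : E3, ‖y‖ < ρ → swirl (fun z => g.symm (V (x₀ + g z))) y = 0) →
    ∀ (V : E3 → E3) (p : E3 → ℝ) (x₀ : E3), IsSteadyNSOn univ V p → (∃ B : ℝ, ∀ x, ‖V x‖ ≤ B) →
      IsUnthreadedAbout x₀ V → Laplacian.laplacian V x₀ = 0 := by
  intro hC1 V p x₀ hNS hB hun
  by_contra hΔ
  have hVan := analyticOnNhd_of_isSteadyNSOn_univ hNS hB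
  have hpan := analyticOnNhd_pressure_of_isSteadyNSOn_univ hNS hB
  obtain ⟨g, -, hrot, hsw⟩ := hC1 V p x₀ 1 one_pos (hVan.mono (subset_univ _)) (hpan.mono (subset_univ _))
    (hNS.of_univ _) (fun x _ => hun x) hΔ
  obtain ⟨b, hb⟩ := eq_const_of_local_symmetry steadyNSGradientBounds steadyClassicalIsMild hNS hVan hB x₀ one_pos g hrot hsw
  have hV : V = fun _ => b := funext hb
  apply hΔ
  rw [hV]
  exact congrFun (InnerProductSpace.laplacian_const (E := E3) (c := b)) x₀

/-- ★★ **R2* without literature hypotheses: `SteadyLocalRigidity → SteadyUnthreadedLiouville`** (bodies verbatim).  Given ONLY the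
(conjectural) master local rigidity C1*, every bounded classical steady Navier–Stokes flow on `ℝ³` whose vortex lines lie on the
spheres about some `x₀` is constant — the steady stratum of W1 (1222) in classical form. -/
theorem steadyUnthreadedLiouville_of_steadyLocalRigidity :
    (∀ (V : E3 → E3) (p : E3 → ℝ) (x₀ : E3) (ρ : ℝ), 0 < ρ →
      AnalyticOnNhd ℝ V (Metric.ball x₀ ρ) → AnalyticOnNhd ℝ p (Metric.ball x₀ ρ) →
      IsSteadyNSOn (Metric.ball x₀ ρ) V p → (∀ x ∈ Metric.ball x₀ ρ, inner ℝ (x - x₀) (curl V x) = 0) →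
      (∃ x ∈ Metric.ball x₀ ρ, curl V x ≠ 0) →
      ∃ g : E3 ≃ₗᵢ[ℝ] E3,
        (∀ θ : ℝ, ∀ y : E3, ‖y‖ < ρ → g.symm (V (x₀ + g (rotZ θ y))) = rotZ θ (g.symm (V (x₀ + g y)))) ∧
        ∀ y : E3, ‖y‖ < ρ → swirl (fun z => g.symm (V (x₀ + g z))) y = 0) →
    ∀ (V : E3 → E3) (p : E3 → ℝ) (x₀ : E3), IsSteadyNSOn univ V p → (∃ B : ℝ, ∀ x, ‖V x‖ ≤ B) →
      IsUnthreadedAbout x₀ V → ∃ b : E3, ∀ x, V x = b := by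
  intro hC1 V p x₀ hNS hB hun
  by_cases hirr : ∀ x, curl V x = 0
  · exact irrotationalSteadyLiouville V p hNS hB hirr
  · push Not at hirr
    obtain ⟨x₁, hx₁⟩ := hirr
    set ρ : ℝ := dist x₁ x₀ + 1 with hρ
    have hρ0 : 0 < ρ := by positivity
    have hx₁ρ : x₁ ∈ Metric.ball x₀ ρ := by
      rw [Metric.mem_ball, hρ]; linarith
    have hVan := analyticOnNhd_of_isSteadyNSOn_univ hNS hB
    have hpan := analyticOnNhd_pressure_of_isSteadyNSOn_univ hNS hB
    obtain ⟨g, hrot, hsw⟩ := hC1 V p x₀ ρ hρ0 (hVan.mono (subset_univ _)) (hpan.mono (subset_univ _))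
      (hNS.of_univ _) (fun x _ => hun x) ⟨x₁, hx₁ρ, hx₁⟩
    exact eq_const_of_local_symmetry steadyNSGradientBounds steadyClassicalIsMild hNS hVan hB x₀ hρ0 g hrot hsw

/-- ★ **C1* alone also gives R1: `SteadyLocalRigidity → NoTypeNCentre`** (bodies verbatim) — through the steady stratum
(`steadyUnthreadedLiouville_of_steadyLocalRigidity`) and «a constant field has `ΔV = 0`» (the sketch's
`noTypeNCentre_of_steadyUnthreadedLiouville`, V17-P4). -/
theorem noTypeNCentre_of_steadyLocalRigidity
    (hC1 : ∀ (V : E3 → E3) (p : E3 → ℝ) (x₀ : E3) (ρ : ℝ), 0 < ρ →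
      AnalyticOnNhd ℝ V (Metric.ball x₀ ρ) → AnalyticOnNhd ℝ p (Metric.ball x₀ ρ) →
      IsSteadyNSOn (Metric.ball x₀ ρ) V p → (∀ x ∈ Metric.ball x₀ ρ, inner ℝ (x - x₀) (curl V x) = 0) →
      (∃ x ∈ Metric.ball x₀ ρ, curl V x ≠ 0) →
      ∃ g : E3 ≃ₗᵢ[ℝ] E3,
        (∀ θ : ℝ, ∀ y : E3, ‖y‖ < ρ → g.symm (V (x₀ + g (rotZ θ y))) = rotZ θ (g.symm (V (x₀ + g y)))) ∧
        ∀ y : E3, ‖y‖ < ρ → swirl (fun z => g.symm (V (x₀ + g z))) y = 0) :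
    ∀ (V : E3 → E3) (p : E3 → ℝ) (x₀ : E3), IsSteadyNSOn univ V p → (∃ B : ℝ, ∀ x, ‖V x‖ ≤ B) →
      IsUnthreadedAbout x₀ V → Laplacian.laplacian V x₀ = 0 := by
  intro V p x₀ hNS hB hun
  obtain ⟨b, hb⟩ := steadyUnthreadedLiouville_of_steadyLocalRigidity hC1 V p x₀ hNS hB hun
  have hV : V = fun _ => b := funext hb
  rw [hV]
  exact congrFun (InnerProductSpace.laplacian_const (E := E3) (c := b)) x₀

/-- For the record: the card's R2 by name needs only F1 now (F2, G1 fed by the tree). -/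
theorem noTypeNCentreOfRigidity_of_F1
    (hF1 : ∀ (U : Set E3) (V : E3 → E3) (p : E3 → ℝ), IsOpen U → IsSteadyNSOn U V p → AnalyticOnNhd ℝ V U ∧ AnalyticOnNhd ℝ p U)
    (hC1 : ∀ (V : E3 → E3) (p : E3 → ℝ) (x₀ : E3) (ρ : ℝ), 0 < ρ →
      AnalyticOnNhd ℝ V (Metric.ball x₀ ρ) → AnalyticOnNhd ℝ p (Metric.ball x₀ ρ) →
      IsSteadyNSOn (Metric.ball x₀ ρ) V p → (∀ x ∈ Metric.ball x₀ ρ, inner ℝ (x - x₀) (curl V x) = 0) →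
      Laplacian.laplacian V x₀ ≠ 0 →
      ∃ g : E3 ≃ₗᵢ[ℝ] E3, (∃ a : ℝ, g (EuclideanSpace.single (2 : Fin 3) (1 : ℝ)) = a • Laplacian.laplacian V x₀) ∧
        (∀ θ : ℝ, ∀ y : E3, ‖y‖ < ρ → g.symm (V (x₀ + g (rotZ θ y))) = rotZ θ (g.symm (V (x₀ + g y)))) ∧
        ∀ y : E3, ‖y‖ < ρ → swirl (fun z => g.symm (V (x₀ + g z))) y = 0) :
    ∀ (V : E3 → E3) (p : E3 → ℝ) (x₀ : E3), IsSteadyNSOn univ V p → (∃ B : ℝ, ∀ x, ‖V x‖ ≤ B) →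
      IsUnthreadedAbout x₀ V → Laplacian.laplacian V x₀ = 0 :=
  noTypeNCentreOfRigidity hF1 steadyNSGradientBounds steadyClassicalIsMild hC1

end Summit.NavierStokesRegularity.NavierStokesRegularity.Theorems.PoloidalLiouville.CentreJet

end
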